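import Summits.ResolutionOfSingularities.ResolutionOfSingularities.Theorems.EquisingularLiftEquisingularLiftNatAffineTwoStepCharts
import HarnessLib

/-!
# [OURS] THE VERTEX CHART PRIME BY PRIME WITH THE DOWNSTAIRS PRIME EXPOSED, and NON-REGULAR EXCEPTIONAL POINTS AT MARKED MAXIMAL IDEALS
# (multi-root form of the level-1 bridge: `D₄`-type points whose exceptional singular points are NOT chart origins)
# (cruxes `Theses.EquisingularLift.EquisingularLiftNat` / `…NatThree` / `EquisingularLift`, stmt-ResolutionOfSingularities-20038 / -20148 / -15660)

[OURS · leafhand-res-equisingularlift-12 g0, 2026-08-31; cell `pub/decomp-res`] AI-produced, weaker than expert review; NOT a statement of any manuscript;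
nothing here proves resolution of singularities in positive characteristic.  DEF-FREE helper; no `sorry`; standard axioms; ZERO named hypotheses.

leafhand-11's level-1 bridge (✓ `OneStep.exists_chartEquiv_regular_or_eq_origin`, ✓ `OneStep.exists_chart_origin_of_not_isRegularLocalRing`,
✓ `OneStep.finite_setOf_not_isRegularLocalRing`) reads the DISJUNCTIVE Jacobian datum «at every prime `P ∋ T_a, G_a` some `∂_jG_a ∉ P` OR `P ⊇ (T)`»: the
strict transform may be singular over the exceptional divisor ONLY AT CHART ORIGINS (`A₃`, the `A`-ladder, simple roots of the `D/E` ladder).  For a `D₄` point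
`x² + y³ + z³`-type (tangent cone a cubic with three distinct roots) the three `A₁` points over it sit at `T = (0, λ, 0)`-type MARKED points of one chart, not at
origins (leafhand-11's remaining list: «[M] D₄ (multi-root generalisation of AffineTwoStepCharts or the LinSubst transport)»).  This file is the multi-root
form of the first two bricks, with the marks ARBITRARY MAXIMAL IDEALS `𝔪 ∈ M a` of `K[T]` (a finite set per chart):

* ★★★ `OneStep.exists_chartEquiv_prime` — the chart isomorphism `χ : K[T]/(G_a) ≃ (A/(f))[Ī/ȳ_a]` (`χ(T̄_a) = ȳ_a`) of p833140 with, for EVERY prime `𝔑 ∋ ȳ_a`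
  of the chart ring, the downstairs prime `P ∋ T_a, G_a` of `K[T]` EXPOSED: `𝔑 = χ(P̄)` and «some `∂_jG_a ∉ P` ⟹ `(A/(f))[Ī/ȳ_a]_𝔑` regular» — the
  datum-free form from which every disjunctive variant (origin, marked points, marked curves) is read off;
* ★★★ `OneStep.exists_chart_marked_of_not_isRegularLocalRing` — MARKED datum «at every prime `P ∋ T_a, G_a`: some `∂_jG_a ∉ P` or `𝔪 ≤ P` for some
  `𝔪 ∈ M a`» (`M a` a finite set of maximal ideals): every NON-REGULAR point `z` of a blow-up `Z → Spec K[y]/(f)` along the origin lying over the origin is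
  `φ w` for a chart `a`, an open immersion `φ` of the chart into `Z` over the base, and the point `w` of the chart with ideal `χ(𝔪̄)`, `𝔪 ∈ M a`;
* ★★ `OneStep.eq_of_sameChart_sameMark` — two such points with the same chart index and the same mark coincide (✓ `IsBlowup.hom_ext`);
* ★★ `OneStep.finite_setOf_not_isRegularLocalRing_marked` — hence the non-regular points over the origin are FINITELY many (at most `Σ_a #M a`).

Remaining for the multi-root level `1` (next hand, S/M each): one-step AT a marked point `χ(𝔪̄)`, `𝔪 = (T_a, T_j − λ_j)`, from one-step data of the
TRANSLATE `G_a(T + λ)` at the origin (✓ `OneStep.oneStepAt_origin` + ✓ `PointChain.oneStepAt_of_iso` along `Spec` of the translation automorphism), closedness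
(Jacobson, as ✓ `OneStep.isClosed_singleton_chartOrigin`), the packaging `twoStepAt_origin_marked` / `twoStepAt_vertex_marked`, and the polynomial `D₄` datum.
Honest label: closes no registered stub.

References: [StacksProject, Tags 0804, 0BIQ]; [GortzWedhorn2020, Prop. 13.91, 13.96]; [Matsumura1987, Thm. 14.2]; through the cited tree files.
-/

set_option linter.dupNamespace false -- mandated namespace `Summit.<Summit>.<Problem>` of this single-conjunct summit

noncomputable section

namespace Summit.ResolutionOfSingularities.ResolutionOfSingularities.Cruxes.EquisingularLiftNat.Sections

section Algebra

open MvPolynomial IsLocalization IsLocalRing Literature.AlgebraicGeometry.Resolution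

namespace OneStep

set_option maxHeartbeats 2400000 in -- the chart algebra `blowupAlgebra` is a subalgebra of a localisation: slow instance unification (as in …NatTwoStepVertexChart)
/-- ★★★ **THE VERTEX CHART PRIME BY PRIME, DOWNSTAIRS PRIME EXPOSED.**  `A = K[y₀,…,y_N]`, `I = (y)`, `f = Φ + Ψ` with `Φ ≠ 0` a form of degree `μ` and
`Ψ ∈ I^{μ+1}`; `G` with `f(T_a, T_aT_j) = T_a^μ·G`.  There is a ring isomorphism `χ : K[T]/(G) ≃+* (A/(f))[Ī/ȳ_a]` with `χ(T̄_a) = ȳ_a` such that every prime `𝔑`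
of the chart ring containing `ȳ_a` is `χ(P̄)` for a prime `P ∋ T_a, G` of `K[T]`, and `𝔑` has regular localisation as soon as some `∂G/∂T_j ∉ P` (Jacobian criterion
transported along `χ`).  Proof = that of ✓ `exists_chartEquiv_regular_or_eq_origin` (p833140) with the last step left to the user. [OURS]
[cite: GortzWedhorn2020, Prop. 13.96] [cite: Matsumura1987, Thm. 14.2] -/
theorem exists_chartEquiv_prime (K : Type) [Field K] {N : ℕ} (Φ Ψ : MvPolynomial (Fin (N + 1)) K) {μ : ℕ}
    (hΦ : Φ.IsHomogeneous μ) (hΦ0 : Φ ≠ 0)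
    (hΨ : Ψ ∈ Ideal.span (Set.range (X : Fin (N + 1) → MvPolynomial (Fin (N + 1)) K)) ^ (μ + 1)) (a : Fin (N + 1))
    (G : MvPolynomial (Fin (N + 1)) K)
    (hG : aeval (fun j => X a * Function.update (X : Fin (N + 1) → MvPolynomial (Fin (N + 1)) K) a 1 j) (Φ + Ψ) = X a ^ μ * G) :
    ∃ χ : (MvPolynomial (Fin (N + 1)) K ⧸ Ideal.span {G}) ≃+*
        blowupAlgebra ((Ideal.span (Set.range (X : Fin (N + 1) → MvPolynomial (Fin (N + 1)) K))).map
          (Ideal.Quotient.mk (Ideal.span {Φ + Ψ}))) (Ideal.Quotient.mk (Ideal.span {Φ + Ψ}) (X a)),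
      χ (Ideal.Quotient.mk (Ideal.span {G}) (X a)) =
        algebraMap (MvPolynomial (Fin (N + 1)) K ⧸ Ideal.span {Φ + Ψ}) _ (Ideal.Quotient.mk (Ideal.span {Φ + Ψ}) (X a)) ∧
      ∀ (𝔑 : Ideal (blowupAlgebra ((Ideal.span (Set.range (X : Fin (N + 1) → MvPolynomial (Fin (N + 1)) K))).map
          (Ideal.Quotient.mk (Ideal.span {Φ + Ψ}))) (Ideal.Quotient.mk (Ideal.span {Φ + Ψ}) (X a)))) [𝔑.IsPrime],
        algebraMap (MvPolynomial (Fin (N + 1)) K ⧸ Ideal.span {Φ + Ψ}) _ (Ideal.Quotient.mk (Ideal.span {Φ + Ψ}) (X a)) ∈ 𝔑 →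
        ∃ P : Ideal (MvPolynomial (Fin (N + 1)) K), P.IsPrime ∧ (X a : MvPolynomial (Fin (N + 1)) K) ∈ P ∧ G ∈ P ∧
          𝔑 = Ideal.map χ.toRingHom (Ideal.map (Ideal.Quotient.mk (Ideal.span {G})) P) ∧
          ((∃ j, pderiv j G ∉ P) → IsRegularLocalRing (Localization.AtPrime 𝔑)) := by
  classical
  have hx : IsQuasiRegular (X : Fin (N + 1) → MvPolynomial (Fin (N + 1)) K) := ConeN.isQuasiRegular_X K (N := N)
  haveI hdom : IsDomain (MvPolynomial (Fin (N + 1)) K ⧸ Ideal.span (Set.range (X : Fin (N + 1) → MvPolynomial (Fin (N + 1)) K))) :=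
    ConeN.isDomain_quotient_origin K (N := N)
  -- the core's presentation `f = t^μ · g₁`, `g₁ = Φ(e) + tψ`
  have hΦ'h : (MvPolynomial.map (C : K →+* MvPolynomial (Fin (N + 1)) K) Φ).IsHomogeneous μ := hΦ.map _
  have heval : MvPolynomial.eval (X : Fin (N + 1) → MvPolynomial (Fin (N + 1)) K) (MvPolynomial.map (C : K →+* MvPolynomial (Fin (N + 1)) K) Φ) = Φ := by
    rw [MvPolynomial.eval_map]
    exact MvPolynomial.eval₂_eta Φ
  obtain ⟨ψ, hcore⟩ := exists_algebraMap_tangentCone_eq (X : Fin (N + 1) → MvPolynomial (Fin (N + 1)) K) a hΦ'h hΨ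
  rw [heval] at hcore
  have hΦbar : MvPolynomial.map (Ideal.Quotient.mk (Ideal.span (Set.range (X : Fin (N + 1) → MvPolynomial (Fin (N + 1)) K))))
      (Literature.AlgebraicGeometry.Resolution.dehomogenize a (MvPolynomial.map (C : K →+* MvPolynomial (Fin (N + 1)) K) Φ)) ≠ 0 := by
    rw [← Literature.AlgebraicGeometry.Resolution.map_dehomogenize, MvPolynomial.map_map]
    haveI : Nontrivial (MvPolynomial (Fin (N + 1)) K ⧸ Ideal.span (Set.range (X : Fin (N + 1) → MvPolynomial (Fin (N + 1)) K))) :=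
      hdom.toNontrivial
    intro h0
    apply Literature.AlgebraicGeometry.Resolution.dehomogenize_ne_zero_of_isHomogeneous a hΦ hΦ0
    exact (MvPolynomial.map_injective _ (RingHom.injective _)) (h0.trans (map_zero _).symm)
  obtain ⟨ε, hε⟩ := exists_quotient_strictTransform_equiv_blowupAlgebra (X : Fin (N + 1) → MvPolynomial (Fin (N + 1)) K) a hx
    hΦbar ψ hcore
  -- `θ : K[T] ≅ A[I/y_a]` takes `G` to `g₁`
  obtain ⟨θ, hθa, hθj⟩ := ConeN.exists_algEquiv_pointChart K (N := N) a
  have hθG := algEquiv_apply_eq_of_subst K a θ hθa hθj hG _ hcore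
  -- `K[T]/(G) ≅ A[I/y_a]/(g₁) ≅ (A/(f))[Ī/ȳ_a]`
  let η : (MvPolynomial (Fin (N + 1)) K ⧸ Ideal.span {G}) ≃+*
      (blowupAlgebra (Ideal.span (Set.range (X : Fin (N + 1) → MvPolynomial (Fin (N + 1)) K))) (X a) ⧸
        Ideal.span {MvPolynomial.aeval (blowupAlgebra.frac (X : Fin (N + 1) → MvPolynomial (Fin (N + 1)) K) a)
          (MvPolynomial.map (C : K →+* MvPolynomial (Fin (N + 1)) K) Φ) +
          algebraMap (MvPolynomial (Fin (N + 1)) K) (blowupAlgebra (Ideal.span (Set.range (X : Fin (N + 1) → MvPolynomial (Fin (N + 1)) K))) (X a))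
            (X a) * ψ}) :=
    Ideal.quotientEquiv _ _ θ.toRingEquiv (by
      rw [Ideal.map_span, Set.image_singleton]
      exact congrArg (fun b => Ideal.span {b}) hθG.symm)
  have he : ∀ q : MvPolynomial (Fin (N + 1)) K, ε (η (Ideal.Quotient.mk _ q)) =
      blowupAlgebra.mapQuotient (Ideal.span (Set.range (X : Fin (N + 1) → MvPolynomial (Fin (N + 1)) K))) (X a) (Ideal.span {Φ + Ψ}) (θ q) :=
    fun q => by rw [show η (Ideal.Quotient.mk _ q) = Ideal.Quotient.mk _ (θ q) from Ideal.quotientEquiv_mk _ _ _ _ q, hε]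
  -- the exceptional equation under `ε ∘ η`
  have hexc : blowupAlgebra.mapQuotient (Ideal.span (Set.range (X : Fin (N + 1) → MvPolynomial (Fin (N + 1)) K))) (X a)
      (Ideal.span {Φ + Ψ}) (PointBlowup.exc N K a) =
      algebraMap (MvPolynomial (Fin (N + 1)) K ⧸ Ideal.span {Φ + Ψ}) _ (Ideal.Quotient.mk (Ideal.span {Φ + Ψ}) (X a)) :=
    blowupAlgebra.mapQuotient_algebraMap _ _ _ (X a)
  refine ⟨η.trans ε, ?_, ?_⟩
  · rw [RingEquiv.trans_apply, he, hθa, hexc]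
  intro 𝔑 _ h𝔑
  -- the primes of `K[T]/(G)` and of `K[T]` under `𝔑`
  obtain ⟨Pbar, hPbar⟩ : ∃ P : Ideal (MvPolynomial (Fin (N + 1)) K ⧸ Ideal.span {G}), P = 𝔑.comap ((η.trans ε).toRingHom) := ⟨_, rfl⟩
  haveI : Pbar.IsPrime := by rw [hPbar]; exact Ideal.comap_isPrime _ 𝔑
  have hmem : ∀ q, q ∈ Pbar ↔ ε (η q) ∈ 𝔑 := fun q => by rw [hPbar, Ideal.mem_comap]; rfl
  obtain ⟨P, hP⟩ : ∃ P : Ideal (MvPolynomial (Fin (N + 1)) K), P = Pbar.comap (Ideal.Quotient.mk (Ideal.span {G})) := ⟨_, rfl⟩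
  haveI : P.IsPrime := by rw [hP]; exact Ideal.comap_isPrime _ Pbar
  have hmemP : ∀ q, q ∈ P ↔ ε (η (Ideal.Quotient.mk _ q)) ∈ 𝔑 := fun q => by rw [hP, Ideal.mem_comap, hmem]
  have haP : (X a : MvPolynomial (Fin (N + 1)) K) ∈ P := by
    rw [hmemP, he, hθa, hexc]
    exact h𝔑
  have hGP : G ∈ P := by
    rw [hmemP, Ideal.Quotient.eq_zero_iff_mem.mpr (Ideal.mem_span_singleton_self G), map_zero, map_zero]
    exact zero_mem _
  have hPbar' : Ideal.map (Ideal.Quotient.mk (Ideal.span {G})) P = Pbar := by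
    rw [hP]; exact Ideal.map_comap_of_surjective _ Ideal.Quotient.mk_surjective Pbar
  have h𝔑' : Ideal.map (η.trans ε).toRingHom Pbar = 𝔑 := by
    rw [hPbar]; exact Ideal.map_comap_of_surjective _ (η.trans ε).surjective 𝔑
  refine ⟨P, inferInstance, haP, hGP, by rw [hPbar', h𝔑'], ?_⟩
  rintro ⟨j, hj⟩
  have hj' : Ideal.Quotient.mk (Ideal.span {G}) (pderiv j G) ∉ Pbar := fun h => hj (by rw [hP, Ideal.mem_comap]; exact h)
  have hreg : IsRegularLocalRing (Localization.AtPrime Pbar) :=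
    Summit.ResolutionOfSingularities.ResolutionOfSingularities.Theorems.MvPolynomial.isRegularLocalRing_localization_quotient_of_pderiv_notMem Pbar j hj'
  exact OrdPoint.isRegularLocalRing_localization_of_ringEquiv (η.trans ε) Pbar 𝔑 (fun q => (hmem q).symm) hreg

end OneStep

end Algebra

section Schemes

open CategoryTheory CategoryTheory.Limits AlgebraicGeometry TopologicalSpace Topology
open MvPolynomial
open Literature.AlgebraicGeometry.Resolution
open AlgebraicGeometry.Scheme.IdealSheafData

namespace OneStep

variable (K : Type) [Field K] {N : ℕ} (Φ Ψ : MvPolynomial (Fin (N + 1)) K) {μ : ℕ}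

set_option maxHeartbeats 800000 in -- the chart algebra `blowupAlgebra` is a subalgebra of a localisation: slow instance unification (as in …NatAffineTwoStepCharts)
/-- ★★ **A NON-REGULAR POINT OF A CHART OVER THE EXCEPTIONAL DIVISOR SITS AT A MARK** — for a FIXED chart isomorphism `χ` with the property of
✓ `exists_chartEquiv_prime`: under the MARKED datum «at every prime `P ∋ T_a, G` some `∂_jG ∉ P` or `𝔪 ≤ P` for some `𝔪 ∈ M`» (`M` a finite set of
maximal ideals of `K[T]`), a point `w` of the chart ring containing `ȳ_a` whose image under an open immersion `φ` into any scheme is non-regular has ideal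
`χ(𝔪̄)` for some `𝔪 ∈ M`. [OURS] [cite: GortzWedhorn2020, Prop. 13.96] -/
theorem exists_mark_of_not_isRegularLocalRing (a : Fin (N + 1)) (G : MvPolynomial (Fin (N + 1)) K)
    (M : Finset (Ideal (MvPolynomial (Fin (N + 1)) K))) (hM : ∀ 𝔪 ∈ M, 𝔪.IsMaximal)
    (hjac : ∀ P : Ideal (MvPolynomial (Fin (N + 1)) K), P.IsPrime → (X a : MvPolynomial (Fin (N + 1)) K) ∈ P → G ∈ P →
      (∃ j, pderiv j G ∉ P) ∨ ∃ 𝔪 ∈ M, 𝔪 ≤ P)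
    (χ : (MvPolynomial (Fin (N + 1)) K ⧸ Ideal.span {G}) ≃+* blowupAlgebra ((Ideal.span (Set.range (X : Fin (N + 1) → MvPolynomial (Fin (N + 1)) K))).map
          (Ideal.Quotient.mk (Ideal.span {Φ + Ψ}))) (Ideal.Quotient.mk (Ideal.span {Φ + Ψ}) (X a)))
    (hχ : ∀ (𝔑 : Ideal (blowupAlgebra ((Ideal.span (Set.range (X : Fin (N + 1) → MvPolynomial (Fin (N + 1)) K))).map
          (Ideal.Quotient.mk (Ideal.span {Φ + Ψ}))) (Ideal.Quotient.mk (Ideal.span {Φ + Ψ}) (X a)))) [𝔑.IsPrime],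
        algebraMap (MvPolynomial (Fin (N + 1)) K ⧸ Ideal.span {Φ + Ψ}) _ (Ideal.Quotient.mk (Ideal.span {Φ + Ψ}) (X a)) ∈ 𝔑 →
        ∃ P : Ideal (MvPolynomial (Fin (N + 1)) K), P.IsPrime ∧ (X a : MvPolynomial (Fin (N + 1)) K) ∈ P ∧ G ∈ P ∧
          𝔑 = Ideal.map χ.toRingHom (Ideal.map (Ideal.Quotient.mk (Ideal.span {G})) P) ∧
          ((∃ j, pderiv j G ∉ P) → IsRegularLocalRing (Localization.AtPrime 𝔑)))
    {Z : Scheme.{0}} (φ : Spec (CommRingCat.of (blowupAlgebra ((Ideal.span (Set.range (X : Fin (N + 1) → MvPolynomial (Fin (N + 1)) K))).map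
          (Ideal.Quotient.mk (Ideal.span {Φ + Ψ}))) (Ideal.Quotient.mk (Ideal.span {Φ + Ψ}) (X a)))) ⟶ Z) [IsOpenImmersion φ] (w : Spec (CommRingCat.of (blowupAlgebra ((Ideal.span (Set.range (X : Fin (N + 1) → MvPolynomial (Fin (N + 1)) K))).map
          (Ideal.Quotient.mk (Ideal.span {Φ + Ψ}))) (Ideal.Quotient.mk (Ideal.span {Φ + Ψ}) (X a)))))
    (hw : algebraMap (MvPolynomial (Fin (N + 1)) K ⧸ Ideal.span {Φ + Ψ}) (blowupAlgebra ((Ideal.span (Set.range (X : Fin (N + 1) → MvPolynomial (Fin (N + 1)) K))).map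
          (Ideal.Quotient.mk (Ideal.span {Φ + Ψ}))) (Ideal.Quotient.mk (Ideal.span {Φ + Ψ}) (X a))) (Ideal.Quotient.mk (Ideal.span {Φ + Ψ}) (X a)) ∈ w.asIdeal)
    (hwreg : ¬ IsRegularLocalRing (Z.presheaf.stalk (φ w))) :
    ∃ 𝔪 ∈ M, w.asIdeal = Ideal.map χ.toRingHom (Ideal.map (Ideal.Quotient.mk (Ideal.span {G})) 𝔪) := by
  haveI : w.asIdeal.IsPrime := w.isPrime
  obtain ⟨P, hP, haP, hGP, hwP, hregP⟩ := hχ w.asIdeal hw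
  rcases hjac P hP haP hGP with hj | ⟨𝔪, h𝔪M, h𝔪P⟩
  · exfalso
    haveI := hregP hj
    exact not_isRegularLocalRing_localization_of_stalk φ w hwreg inferInstance
  · refine ⟨𝔪, h𝔪M, ?_⟩
    rw [hwP, ((hM 𝔪 h𝔪M).eq_of_le hP.ne_top h𝔪P)]

set_option maxHeartbeats 800000 in -- the chart algebra `blowupAlgebra` is a subalgebra of a localisation: slow instance unification (as in …NatAffineTwoStepCharts)
/-- ★★★ **NON-REGULAR POINTS OVER THE ORIGIN SIT AT MARKED POINTS OF THE CHARTS** (chart isomorphisms `χ_a` FIXED, with the property of ✓ `exists_chartEquiv_prime`).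
`f = Φ + Ψ`; for every chart `a` a strict transform `G_a`, a finite set `M a` of MAXIMAL ideals of `K[T]`, and the MARKED datum «at every prime `P ∋ T_a, G_a` some
`∂_jG_a ∉ P` or `𝔪 ≤ P` for some `𝔪 ∈ M a`».  Let `ρ : Z → Spec (K[y]/(f))` be a blow-up along the origin and `z` a point over the origin whose local ring is NOT
regular.  Then for some `a`: an open immersion `φ` of the chart into `Z` over the base, a mark `𝔪 ∈ M a` and the point `w` of the chart with ideal `χ_a(𝔪̄)`, with
`φ w = z`.  (✓ `exists_chart_origin_of_not_isRegularLocalRing` is the case `M a = {(T)}`.) [OURS] [cite: StacksProject, Tag 0804] [cite: GortzWedhorn2020, Prop. 13.96] -/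
theorem exists_chart_marked_of_not_isRegularLocalRing' (G : Fin (N + 1) → MvPolynomial (Fin (N + 1)) K)
    (M : Fin (N + 1) → Finset (Ideal (MvPolynomial (Fin (N + 1)) K))) (hM : ∀ a, ∀ 𝔪 ∈ M a, 𝔪.IsMaximal)
    (hjac : ∀ a, ∀ P : Ideal (MvPolynomial (Fin (N + 1)) K), P.IsPrime → (X a : MvPolynomial (Fin (N + 1)) K) ∈ P → G a ∈ P →
      (∃ j, pderiv j (G a) ∉ P) ∨ ∃ 𝔪 ∈ M a, 𝔪 ≤ P)
    (χ : ∀ a : Fin (N + 1), (MvPolynomial (Fin (N + 1)) K ⧸ Ideal.span {G a}) ≃+* blowupAlgebra ((Ideal.span (Set.range (X : Fin (N + 1) → MvPolynomial (Fin (N + 1)) K))).map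
          (Ideal.Quotient.mk (Ideal.span {Φ + Ψ}))) (Ideal.Quotient.mk (Ideal.span {Φ + Ψ}) (X a)))
    (hχ : ∀ (a : Fin (N + 1)) (𝔑 : Ideal (blowupAlgebra ((Ideal.span (Set.range (X : Fin (N + 1) → MvPolynomial (Fin (N + 1)) K))).map
          (Ideal.Quotient.mk (Ideal.span {Φ + Ψ}))) (Ideal.Quotient.mk (Ideal.span {Φ + Ψ}) (X a)))) [𝔑.IsPrime],
        algebraMap (MvPolynomial (Fin (N + 1)) K ⧸ Ideal.span {Φ + Ψ}) _ (Ideal.Quotient.mk (Ideal.span {Φ + Ψ}) (X a)) ∈ 𝔑 →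
        ∃ P : Ideal (MvPolynomial (Fin (N + 1)) K), P.IsPrime ∧ (X a : MvPolynomial (Fin (N + 1)) K) ∈ P ∧ G a ∈ P ∧
          𝔑 = Ideal.map (χ a).toRingHom (Ideal.map (Ideal.Quotient.mk (Ideal.span {G a})) P) ∧
          ((∃ j, pderiv j (G a) ∉ P) → IsRegularLocalRing (Localization.AtPrime 𝔑)))
    {Z : Scheme.{0}} {ρ : Z ⟶ Spec (CommRingCat.of (MvPolynomial (Fin (N + 1)) K ⧸ Ideal.span {Φ + Ψ}))}
    (hρ : IsBlowup ρ (ofIdealTop (Ideal.map (Scheme.ΓSpecIso (CommRingCat.of (MvPolynomial (Fin (N + 1)) K ⧸ Ideal.span {Φ + Ψ}))).inv.hom (Ideal.map (Ideal.Quotient.mk (Ideal.span {Φ + Ψ})) (Ideal.span (Set.range (X : Fin (N + 1) → MvPolynomial (Fin (N + 1)) K))))))) (z : Z) (hz : ρ z ∈ ((ofIdealTop (Ideal.map (Scheme.ΓSpecIso (CommRingCat.of (MvPolynomial (Fin (N + 1)) K ⧸ Ideal.span {Φ + Ψ}))).inv.hom (Ideal.map (Ideal.Quotient.mk (Ideal.span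 {Φ + Ψ})) (Ideal.span (Set.range (X : Fin (N + 1) → MvPolynomial (Fin (N + 1)) K)))))).support : Set (Spec (CommRingCat.of (MvPolynomial (Fin (N + 1)) K ⧸ Ideal.span {Φ + Ψ}))))) (hzreg : ¬ IsRegularLocalRing (Z.presheaf.stalk z)) :
    ∃ (a : Fin (N + 1)) (φ : Spec (CommRingCat.of (blowupAlgebra ((Ideal.span (Set.range (X : Fin (N + 1) → MvPolynomial (Fin (N + 1)) K))).map
          (Ideal.Quotient.mk (Ideal.span {Φ + Ψ}))) (Ideal.Quotient.mk (Ideal.span {Φ + Ψ}) (X a)))) ⟶ Z) (_ : IsOpenImmersion φ) (𝔪 : Ideal (MvPolynomial (Fin (N + 1)) K))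
      (w : Spec (CommRingCat.of (blowupAlgebra ((Ideal.span (Set.range (X : Fin (N + 1) → MvPolynomial (Fin (N + 1)) K))).map
          (Ideal.Quotient.mk (Ideal.span {Φ + Ψ}))) (Ideal.Quotient.mk (Ideal.span {Φ + Ψ}) (X a))))),
      𝔪 ∈ M a ∧
      φ ≫ ρ = Spec.map (CommRingCat.ofHom (algebraMap (MvPolynomial (Fin (N + 1)) K ⧸ Ideal.span {Φ + Ψ}) (blowupAlgebra ((Ideal.span (Set.range (X : Fin (N + 1) → MvPolynomial (Fin (N + 1)) K))).map
          (Ideal.Quotient.mk (Ideal.span {Φ + Ψ}))) (Ideal.Quotient.mk (Ideal.span {Φ + Ψ}) (X a))))) ∧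
      w.asIdeal = Ideal.map (χ a).toRingHom (Ideal.map (Ideal.Quotient.mk (Ideal.span {G a})) 𝔪) ∧
      φ w = z := by
  classical
  let g : Fin (N + 1) → (MvPolynomial (Fin (N + 1)) K ⧸ Ideal.span {Φ + Ψ}) := fun i => Ideal.Quotient.mk (Ideal.span {Φ + Ψ}) (X i)
  have hg : Ideal.span (Set.range g) =
      Ideal.map (Ideal.Quotient.mk (Ideal.span {Φ + Ψ})) (Ideal.span (Set.range (X : Fin (N + 1) → MvPolynomial (Fin (N + 1)) K))) := by
    rw [Ideal.map_span, ← Set.range_comp]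
    rfl
  obtain ⟨a, φ, hφ, hzφ, hφρ⟩ := IsBlowup.exists_chart_of_span_range_eq
    (A := CommRingCat.of (MvPolynomial (Fin (N + 1)) K ⧸ Ideal.span {Φ + Ψ})) hρ g hg z
  obtain ⟨w, hw⟩ := hzφ
  have hbw : algebraMap (MvPolynomial (Fin (N + 1)) K ⧸ Ideal.span {Φ + Ψ})
      (blowupAlgebra (Ideal.map (Ideal.Quotient.mk (Ideal.span {Φ + Ψ}))
        (Ideal.span (Set.range (X : Fin (N + 1) → MvPolynomial (Fin (N + 1)) K)))) (g a)) (g a) ∈ w.asIdeal := by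
    have hyw : ρ z = Spec.map (CommRingCat.ofHom (algebraMap (MvPolynomial (Fin (N + 1)) K ⧸ Ideal.span {Φ + Ψ})
        (blowupAlgebra (Ideal.map (Ideal.Quotient.mk (Ideal.span {Φ + Ψ}))
          (Ideal.span (Set.range (X : Fin (N + 1) → MvPolynomial (Fin (N + 1)) K)))) (g a)))) w := by
      rw [← hw]
      exact congrArg (fun f => f w) hφρ
    have hy' := hz
    rw [hyw, Scheme.IdealSheafData.coe_support_ofIdealTop, Spec_zeroLocus, Spec.map_apply] at hy'
    have hmem : g a ∈ (Scheme.ΓSpecIso (CommRingCat.of (MvPolynomial (Fin (N + 1)) K ⧸ Ideal.span {Φ + Ψ}))).inv ⁻¹'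
        ((Ideal.map (Scheme.ΓSpecIso (CommRingCat.of (MvPolynomial (Fin (N + 1)) K ⧸ Ideal.span {Φ + Ψ}))).inv.hom
          (Ideal.map (Ideal.Quotient.mk (Ideal.span {Φ + Ψ})) (Ideal.span (Set.range (X : Fin (N + 1) → MvPolynomial (Fin (N + 1)) K))))) : Set _) :=
      Ideal.mem_map_of_mem _ (hg ▸ Ideal.subset_span ⟨a, rfl⟩)
    have h := (PrimeSpectrum.mem_zeroLocus _ _).mp hy' hmem
    rw [PrimeSpectrum.comap_asIdeal] at h
    exact h
  haveI := hφ
  have hzreg' : ¬ IsRegularLocalRing (Z.presheaf.stalk (φ w)) := by rw [hw]; exact hzreg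
  obtain ⟨𝔪, h𝔪M, hw𝔪⟩ := exists_mark_of_not_isRegularLocalRing K Φ Ψ a (G a) (M a) (hM a) (hjac a) (χ a) (hχ a) φ w hbw hzreg'
  exact ⟨a, φ, hφ, 𝔪, w, h𝔪M, hφρ, hw𝔪, hw⟩

set_option maxHeartbeats 800000 in -- the chart algebra `blowupAlgebra` is a subalgebra of a localisation: slow instance unification (as in …NatAffineTwoStepCharts)
/-- ★★★ **NON-REGULAR POINTS OVER THE ORIGIN SIT AT MARKED POINTS OF THE CHARTS** (self-contained form: the chart isomorphism is produced).
[OURS] [cite: StacksProject, Tag 0804] [cite: GortzWedhorn2020, Prop. 13.96] -/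
theorem exists_chart_marked_of_not_isRegularLocalRing (hΦ : Φ.IsHomogeneous μ) (hΦ0 : Φ ≠ 0)
    (hΨ : Ψ ∈ Ideal.span (Set.range (X : Fin (N + 1) → MvPolynomial (Fin (N + 1)) K)) ^ (μ + 1))
    (G : Fin (N + 1) → MvPolynomial (Fin (N + 1)) K)
    (hG : ∀ a, aeval (fun j => X a * Function.update (X : Fin (N + 1) → MvPolynomial (Fin (N + 1)) K) a 1 j) (Φ + Ψ) = X a ^ μ * G a)
    (M : Fin (N + 1) → Finset (Ideal (MvPolynomial (Fin (N + 1)) K))) (hM : ∀ a, ∀ 𝔪 ∈ M a, 𝔪.IsMaximal)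
    (hjac : ∀ a, ∀ P : Ideal (MvPolynomial (Fin (N + 1)) K), P.IsPrime → (X a : MvPolynomial (Fin (N + 1)) K) ∈ P → G a ∈ P →
      (∃ j, pderiv j (G a) ∉ P) ∨ ∃ 𝔪 ∈ M a, 𝔪 ≤ P)
    {Z : Scheme.{0}} {ρ : Z ⟶ Spec (CommRingCat.of (MvPolynomial (Fin (N + 1)) K ⧸ Ideal.span {Φ + Ψ}))}
    (hρ : IsBlowup ρ (ofIdealTop (Ideal.map (Scheme.ΓSpecIso (CommRingCat.of (MvPolynomial (Fin (N + 1)) K ⧸ Ideal.span {Φ + Ψ}))).inv.hom (Ideal.map (Ideal.Quotient.mk (Ideal.span {Φ + Ψ})) (Ideal.span (Set.range (X : Fin (N + 1) → MvPolynomial (Fin (N + 1)) K))))))) (z : Z) (hz : ρ z ∈ ((ofIdealTop (Ideal.map (Scheme.ΓSpecIso (CommRingCat.of (MvPolynomial (Fin (N + 1)) K ⧸ Ideal.span {Φ + Ψ}))).inv.hom (Ideal.map (Ideal.Quotient.mk (Ideal.span {Φ + Ψ})) (Ideal.span (Set.range (X : Fin (N + 1) → MvPolynomial (Fin (N + 1))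 K)))))).support : Set (Spec (CommRingCat.of (MvPolynomial (Fin (N + 1)) K ⧸ Ideal.span {Φ + Ψ}))))) (hzreg : ¬ IsRegularLocalRing (Z.presheaf.stalk z)) :
    ∃ (a : Fin (N + 1)) (χ : (MvPolynomial (Fin (N + 1)) K ⧸ Ideal.span {G a}) ≃+* blowupAlgebra ((Ideal.span (Set.range (X : Fin (N + 1) → MvPolynomial (Fin (N + 1)) K))).map
          (Ideal.Quotient.mk (Ideal.span {Φ + Ψ}))) (Ideal.Quotient.mk (Ideal.span {Φ + Ψ}) (X a)))
      (φ : Spec (CommRingCat.of (blowupAlgebra ((Ideal.span (Set.range (X : Fin (N + 1) → MvPolynomial (Fin (N + 1)) K))).map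
          (Ideal.Quotient.mk (Ideal.span {Φ + Ψ}))) (Ideal.Quotient.mk (Ideal.span {Φ + Ψ}) (X a)))) ⟶ Z) (_ : IsOpenImmersion φ) (𝔪 : Ideal (MvPolynomial (Fin (N + 1)) K))
      (w : Spec (CommRingCat.of (blowupAlgebra ((Ideal.span (Set.range (X : Fin (N + 1) → MvPolynomial (Fin (N + 1)) K))).map
          (Ideal.Quotient.mk (Ideal.span {Φ + Ψ}))) (Ideal.Quotient.mk (Ideal.span {Φ + Ψ}) (X a))))),
      𝔪 ∈ M a ∧
      χ (Ideal.Quotient.mk (Ideal.span {G a}) (X a)) =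
        algebraMap (MvPolynomial (Fin (N + 1)) K ⧸ Ideal.span {Φ + Ψ}) _ (Ideal.Quotient.mk (Ideal.span {Φ + Ψ}) (X a)) ∧
      φ ≫ ρ = Spec.map (CommRingCat.ofHom (algebraMap (MvPolynomial (Fin (N + 1)) K ⧸ Ideal.span {Φ + Ψ}) (blowupAlgebra ((Ideal.span (Set.range (X : Fin (N + 1) → MvPolynomial (Fin (N + 1)) K))).map
          (Ideal.Quotient.mk (Ideal.span {Φ + Ψ}))) (Ideal.Quotient.mk (Ideal.span {Φ + Ψ}) (X a))))) ∧
      w.asIdeal = Ideal.map χ.toRingHom (Ideal.map (Ideal.Quotient.mk (Ideal.span {G a})) 𝔪) ∧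
      φ w = z := by
  have hχall := fun a : Fin (N + 1) => exists_chartEquiv_prime K Φ Ψ hΦ hΦ0 hΨ a (G a) (hG a)
  choose χ hχa hχ using hχall
  obtain ⟨a, φ, hφ, 𝔪, w, h𝔪M, hφρ, hw𝔪, hw⟩ :=
    exists_chart_marked_of_not_isRegularLocalRing' K Φ Ψ G M hM hjac χ (fun a 𝔑 _ h => hχ a 𝔑 h) hρ z hz hzreg
  exact ⟨a, χ a, φ, hφ, 𝔪, w, h𝔪M, hχa a, hφρ, hw𝔪, hw⟩

set_option maxHeartbeats 800000 in -- the chart algebra `blowupAlgebra` is a subalgebra of a localisation: slow instance unification (as in …NatAffineTwoStepCharts)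
/-- ★★ **Same chart index and same mark ⟹ same point**: two charts of the same index agree (✓ `IsBlowup.hom_ext`, the centre pulling back to an effective
Cartier divisor along the flat open immersion), and in a fixed chart the point with ideal `χ_a(𝔪̄)` is unique. [OURS] [cite: StacksProject, Tag 0804] -/
theorem eq_of_sameChart_sameMark (G : Fin (N + 1) → MvPolynomial (Fin (N + 1)) K)
    (χ : ∀ a : Fin (N + 1), (MvPolynomial (Fin (N + 1)) K ⧸ Ideal.span {G a}) ≃+* blowupAlgebra ((Ideal.span (Set.range (X : Fin (N + 1) → MvPolynomial (Fin (N + 1)) K))).map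
          (Ideal.Quotient.mk (Ideal.span {Φ + Ψ}))) (Ideal.Quotient.mk (Ideal.span {Φ + Ψ}) (X a)))
    {Z : Scheme.{0}} {ρ : Z ⟶ Spec (CommRingCat.of (MvPolynomial (Fin (N + 1)) K ⧸ Ideal.span {Φ + Ψ}))}
    (hρ : IsBlowup ρ (ofIdealTop (Ideal.map (Scheme.ΓSpecIso (CommRingCat.of (MvPolynomial (Fin (N + 1)) K ⧸ Ideal.span {Φ + Ψ}))).inv.hom (Ideal.map (Ideal.Quotient.mk (Ideal.span {Φ + Ψ})) (Ideal.span (Set.range (X : Fin (N + 1) → MvPolynomial (Fin (N + 1)) K)))))))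
    (a₁ a₂ : Fin (N + 1)) (ha : a₁ = a₂)
    (φ₁ : Spec (CommRingCat.of (blowupAlgebra ((Ideal.span (Set.range (X : Fin (N + 1) → MvPolynomial (Fin (N + 1)) K))).map
          (Ideal.Quotient.mk (Ideal.span {Φ + Ψ}))) (Ideal.Quotient.mk (Ideal.span {Φ + Ψ}) (X a₁)))) ⟶ Z) [IsOpenImmersion φ₁]
    (φ₂ : Spec (CommRingCat.of (blowupAlgebra ((Ideal.span (Set.range (X : Fin (N + 1) → MvPolynomial (Fin (N + 1)) K))).map
          (Ideal.Quotient.mk (Ideal.span {Φ + Ψ}))) (Ideal.Quotient.mk (Ideal.span {Φ + Ψ}) (X a₂)))) ⟶ Z) [IsOpenImmersion φ₂]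
    (hφ₁ : φ₁ ≫ ρ = Spec.map (CommRingCat.ofHom (algebraMap (MvPolynomial (Fin (N + 1)) K ⧸ Ideal.span {Φ + Ψ}) (blowupAlgebra ((Ideal.span (Set.range (X : Fin (N + 1) → MvPolynomial (Fin (N + 1)) K))).map
          (Ideal.Quotient.mk (Ideal.span {Φ + Ψ}))) (Ideal.Quotient.mk (Ideal.span {Φ + Ψ}) (X a₁))))))
    (hφ₂ : φ₂ ≫ ρ = Spec.map (CommRingCat.ofHom (algebraMap (MvPolynomial (Fin (N + 1)) K ⧸ Ideal.span {Φ + Ψ}) (blowupAlgebra ((Ideal.span (Set.range (X : Fin (N + 1) → MvPolynomial (Fin (N + 1)) K))).map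
          (Ideal.Quotient.mk (Ideal.span {Φ + Ψ}))) (Ideal.Quotient.mk (Ideal.span {Φ + Ψ}) (X a₂))))))
    (𝔪₁ 𝔪₂ : Ideal (MvPolynomial (Fin (N + 1)) K)) (h𝔪 : 𝔪₁ = 𝔪₂)
    (w₁ : Spec (CommRingCat.of (blowupAlgebra ((Ideal.span (Set.range (X : Fin (N + 1) → MvPolynomial (Fin (N + 1)) K))).map
          (Ideal.Quotient.mk (Ideal.span {Φ + Ψ}))) (Ideal.Quotient.mk (Ideal.span {Φ + Ψ}) (X a₁))))) (w₂ : Spec (CommRingCat.of (blowupAlgebra ((Ideal.span (Set.range (X : Fin (N + 1) → MvPolynomial (Fin (N + 1)) K))).map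
          (Ideal.Quotient.mk (Ideal.span {Φ + Ψ}))) (Ideal.Quotient.mk (Ideal.span {Φ + Ψ}) (X a₂)))))
    (hw₁ : w₁.asIdeal = Ideal.map (χ a₁).toRingHom (Ideal.map (Ideal.Quotient.mk (Ideal.span {G a₁})) 𝔪₁))
    (hw₂ : w₂.asIdeal = Ideal.map (χ a₂).toRingHom (Ideal.map (Ideal.Quotient.mk (Ideal.span {G a₂})) 𝔪₂)) :
    φ₁ w₁ = φ₂ w₂ := by
  subst ha
  subst h𝔪
  have hcart : IsEffectiveCartier (((ofIdealTop (Ideal.map (Scheme.ΓSpecIso (CommRingCat.of (MvPolynomial (Fin (N + 1)) K ⧸ Ideal.span {Φ + Ψ}))).inv.hom (Ideal.map (Ideal.Quotient.mk (Ideal.span {Φ + Ψ})) (Ideal.span (Set.range (X : Fin (N + 1) → MvPolynomial (Fin (N + 1)) K))))))).comap (φ₁ ≫ ρ)) := by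
    rw [Scheme.IdealSheafData.comap_comp]
    exact hρ.isEffectiveCartier.comap_of_flat _
  have hφ : φ₁ = φ₂ := hρ.hom_ext hcart (hφ₁.trans hφ₂.symm)
  subst hφ
  rw [PrimeSpectrum.ext (hw₁.trans hw₂.symm)]

set_option maxHeartbeats 800000 in -- the chart algebra `blowupAlgebra` is a subalgebra of a localisation: slow instance unification (as in …NatAffineTwoStepCharts)
/-- ★★ **THE NON-REGULAR POINTS OVER THE ORIGIN ARE FINITELY MANY** under the marked datum: the map «point ↦ (chart index, mark)» is injective on them
(✓ `eq_of_sameChart_sameMark`) and lands in the finite set `{(a, 𝔪) | 𝔪 ∈ M a}`. [OURS] [cite: StacksProject, Tag 0804] -/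
theorem finite_setOf_not_isRegularLocalRing_marked (hΦ : Φ.IsHomogeneous μ) (hΦ0 : Φ ≠ 0)
    (hΨ : Ψ ∈ Ideal.span (Set.range (X : Fin (N + 1) → MvPolynomial (Fin (N + 1)) K)) ^ (μ + 1))
    (G : Fin (N + 1) → MvPolynomial (Fin (N + 1)) K)
    (hG : ∀ a, aeval (fun j => X a * Function.update (X : Fin (N + 1) → MvPolynomial (Fin (N + 1)) K) a 1 j) (Φ + Ψ) = X a ^ μ * G a)
    (M : Fin (N + 1) → Finset (Ideal (MvPolynomial (Fin (N + 1)) K))) (hM : ∀ a, ∀ 𝔪 ∈ M a, 𝔪.IsMaximal)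
    (hjac : ∀ a, ∀ P : Ideal (MvPolynomial (Fin (N + 1)) K), P.IsPrime → (X a : MvPolynomial (Fin (N + 1)) K) ∈ P → G a ∈ P →
      (∃ j, pderiv j (G a) ∉ P) ∨ ∃ 𝔪 ∈ M a, 𝔪 ≤ P)
    {Z : Scheme.{0}} {ρ : Z ⟶ Spec (CommRingCat.of (MvPolynomial (Fin (N + 1)) K ⧸ Ideal.span {Φ + Ψ}))}
    (hρ : IsBlowup ρ (ofIdealTop (Ideal.map (Scheme.ΓSpecIso (CommRingCat.of (MvPolynomial (Fin (N + 1)) K ⧸ Ideal.span {Φ + Ψ}))).inv.hom (Ideal.map (Ideal.Quotient.mk (Ideal.span {Φ + Ψ})) (Ideal.span (Set.range (X : Fin (N + 1) → MvPolynomial (Fin (N + 1)) K))))))) :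
    Set.Finite {z : Z | ρ z ∈ ((ofIdealTop (Ideal.map (Scheme.ΓSpecIso (CommRingCat.of (MvPolynomial (Fin (N + 1)) K ⧸ Ideal.span {Φ + Ψ}))).inv.hom (Ideal.map (Ideal.Quotient.mk (Ideal.span {Φ + Ψ})) (Ideal.span (Set.range (X : Fin (N + 1) → MvPolynomial (Fin (N + 1)) K)))))).support : Set (Spec (CommRingCat.of (MvPolynomial (Fin (N + 1)) K ⧸ Ideal.span {Φ + Ψ})))) ∧ ¬ IsRegularLocalRing (Z.presheaf.stalk z)} := by
  classical
  have hχall := fun a : Fin (N + 1) => exists_chartEquiv_prime K Φ Ψ hΦ hΦ0 hΨ a (G a) (hG a)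
  choose χ hχa hχ using hχall
  have hch := fun (z : Z) (h : ρ z ∈ ((ofIdealTop (Ideal.map (Scheme.ΓSpecIso (CommRingCat.of (MvPolynomial (Fin (N + 1)) K ⧸ Ideal.span {Φ + Ψ}))).inv.hom (Ideal.map (Ideal.Quotient.mk (Ideal.span {Φ + Ψ})) (Ideal.span (Set.range (X : Fin (N + 1) → MvPolynomial (Fin (N + 1)) K)))))).support : Set (Spec (CommRingCat.of (MvPolynomial (Fin (N + 1)) K ⧸ Ideal.span {Φ + Ψ})))) ∧ ¬ IsRegularLocalRing (Z.presheaf.stalk z)) =>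
    exists_chart_marked_of_not_isRegularLocalRing' K Φ Ψ G M hM hjac χ (fun a 𝔑 _ h => hχ a 𝔑 h) hρ z h.1 h.2
  choose a φ hφ 𝔪 w h𝔪M hφρ hw𝔪 hφw using hch
  let T : Set (Fin (N + 1) × Ideal (MvPolynomial (Fin (N + 1)) K)) := {q | q.2 ∈ M q.1}
  have hTfin : T.Finite := by
    have h : T ⊆ ⋃ b : Fin (N + 1), (fun 𝔫 => (b, 𝔫)) '' (M b : Set (Ideal (MvPolynomial (Fin (N + 1)) K))) := by
      rintro ⟨b, 𝔫⟩ hq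
      exact Set.mem_iUnion.mpr ⟨b, 𝔫, hq, rfl⟩
    exact Set.Finite.subset (Set.finite_iUnion fun b => (M b).finite_toSet.image _) h
  refine Set.Finite.of_finite_image (f := fun z => if h : ρ z ∈ ((ofIdealTop (Ideal.map (Scheme.ΓSpecIso (CommRingCat.of (MvPolynomial (Fin (N + 1)) K ⧸ Ideal.span {Φ + Ψ}))).inv.hom (Ideal.map (Ideal.Quotient.mk (Ideal.span {Φ + Ψ})) (Ideal.span (Set.range (X : Fin (N + 1) → MvPolynomial (Fin (N + 1)) K)))))).support : Set (Spec (CommRingCat.of (MvPolynomial (Fin (N + 1)) K ⧸ Ideal.span {Φ + Ψ})))) ∧ ¬ IsRegularLocalRing (Z.presheaf.stalk z) then (a z h, 𝔪 z h)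
      else ((0 : Fin (N + 1)), (⊤ : Ideal (MvPolynomial (Fin (N + 1)) K)))) (hTfin.subset ?_) ?_
  · rintro _ ⟨z₁, hz₁, rfl⟩
    simp only [Set.mem_setOf_eq] at hz₁
    simp only [dif_pos hz₁]
    exact h𝔪M z₁ hz₁
  intro z₁ hz₁ z₂ hz₂ heq
  simp only [Set.mem_setOf_eq] at hz₁ hz₂
  simp only [dif_pos hz₁, dif_pos hz₂] at heq
  obtain ⟨ha, h𝔪⟩ := Prod.mk.injEq _ _ _ _ ▸ heq
  haveI := hφ z₁ hz₁
  haveI := hφ z₂ hz₂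
  rw [← hφw z₁ hz₁, ← hφw z₂ hz₂]
  exact eq_of_sameChart_sameMark K Φ Ψ G χ hρ (a z₁ hz₁) (a z₂ hz₂) ha (φ z₁ hz₁) (φ z₂ hz₂) (hφρ z₁ hz₁) (hφρ z₂ hz₂)
    (𝔪 z₁ hz₁) (𝔪 z₂ hz₂) h𝔪 (w z₁ hz₁) (w z₂ hz₂) (hw𝔪 z₁ hz₁) (hw𝔪 z₂ hz₂)

end OneStep

end Schemes

end Summit.ResolutionOfSingularities.ResolutionOfSingularities.Cruxes.EquisingularLiftNat.Sections

end
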